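import Literature.NumberTheory.Automorphic.Liu2021.LemD1AsPrintedIndexedNonVacuityInertCofinite
import Mathlib.RingTheory.Invariant.Basic
import Mathlib.NumberTheory.RamificationInertia.Galois
import Mathlib.NumberTheory.NumberField.Ideal.Basic
import Mathlib.FieldTheory.Finite.Basic
import HarnessLib

/-!
# [Liu2021, App. D §D.1 Step 3 ∕ Lemma D.1 (3)] bookkeeping at INERT places of ANY quadratic `E/F`: the residue action of
# `c` at a non-split unramified place IS THE FROBENIUS, and the INERT TORSION WITNESS `ζ = u / c(u)` it produces

Reproduction ∕ bookkeeping (Literature, THEOREMS ONLY: no definition, no record, no named fact, no `sorry`; nothing is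
asserted about Liu's oscillator representations or about the tree's constructed local Weil carriers).

Sequel of `LemD1AsPrintedIndexedNonVacuityTorsionCarrier.lean` and `…WildCarrier.lean`.  Those two files realise the
`μ`-conjunct of [Lem. D.1 (3)] AS PRINTED as the ONLY separating conjunct at a NON-SPLIT place `w` from a character of
`E_w¹` of order dividing `N` that is trivial on a level subgroup but not on `E_w¹`; they obtain it from a GLOBAL norm-one
element `ζ ∈ E` (`ζ · c(ζ) = 1`) with `v_w(ζ^N − 1) < v_w(ζ − 1)` — a root of unity of order dividing `N` (torsion carrier:
needs `ζ_m ∈ E`), or a principal unit (wild carrier: needs `w ∣ N`).  Their «What this does NOT give» names the remaining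
case: a TAME non-split place (`w ∤ N`) of a quadratic `E/F` WITHOUT norm-one torsion of order dividing `N`, «governed by
`gcd(N, |κ_w¹|)` at inert `w` — needs the Frobenius action of `c` on `κ(w)`, not in the tree».  THIS FILE supplies exactly
that action and the witness it yields, for ANY quadratic extension of number fields `E/F` with non-trivial `F`-automorphism
`c` (no CM hypothesis, no `δ`, no hermitian space):

* §1 (generalities; `c² = 1` is the tree's `HeckeCharacter.CMQuadraticExtension.mul_self_eq_one`) at a non-split place
  `w = c • w` the `w`-adic valuation is `c`-invariant (tree `HeightOneSpectrum.valuation_algEquiv_smul`) and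
  `c • u ∈ 𝔭_w ↔ u ∈ 𝔭_w`; `c` lies in the decomposition group of `𝔭_w`.
* §2 **THE FROBENIUS CONGRUENCE** `smul_sub_pow_card_mem`: at a place `v` of `F` UNRAMIFIED in `E` and a place `w ∣ v` with
  `c • w = w` (so `w` is INERT: `f(w|v) = 2`, tree `…InertCofinite.inertiaDeg_eq_two_of_smul_eq_of_isUnramifiedIn`),
  `c • u ≡ u^{q_v} (mod 𝔭_w)` for EVERY `u ∈ 𝓞_E`, `q_v = #(𝓞_F ∕ 𝔭_v)`.  PROOF (Hilbert's ramification theory as Mathlib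
  has it): `c` lies in the decomposition group of `𝔭_w`; the homomorphism `D_w → Gal(κ(w)/κ(v))` (Mathlib
  `Ideal.Quotient.stabilizerHom`) has kernel the inertia group, of order `e(w|v) = 1` (Mathlib
  `Ideal.card_inertia_eq_ramificationIdxIn`), so the image `c̄` of `c ≠ 1` is `≠ 1`; `Gal(κ(w)/κ(v))` consists of the
  `[κ(w) : κ(v)] = 2` powers of the `q_v`-Frobenius (Mathlib `FiniteField.bijective_frobeniusAlgEquivOfAlgebraic_pow`), hence
  `c̄ = Frob_{q_v}`.  Also `card_residueField_eq_sq`: `#κ(w) = q_v²`.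
* §3 **THE INERT TORSION WITNESS** `exists_norm_one_inert_witness`: at such `(v, w)`, for every prime `ℓ ∣ q_v + 1` there is
  `ζ ∈ E` with `ζ · c(ζ) = 1`, `v_w(ζ − 1) = 1` and `v_w(ζ^ℓ − 1) < 1` — i.e. the class of `ζ` in `κ(w)ˣ` has order exactly
  `ℓ`.  PROOF: `κ(w)ˣ` is cyclic of order `q_v² − 1 = (q_v + 1)(q_v − 1)`; for a generator `g` put `ū = g^{(q_v+1)/ℓ}`; then
  `ū^{q_v − 1} = g^{(q_v² − 1)/ℓ} ≠ 1` while `ū^{(q_v − 1)ℓ} = 1`; lift `ū` to `u ∈ 𝓞_E` and put `ζ = u / c(u)`: by §2,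
  `ζ ≡ ū^{1 − q_v} (mod 𝔭_w)`, so `ζ ≢ 1` and `ζ^ℓ ≡ 1`; `ζ · c(ζ) = (u / c u)(c u / c² u) = 1` by §1.  The `N`-form
  `exists_norm_one_inert_witness_of_not_coprime`: for every `N` NOT coprime to `q_v + 1` a norm-one `ζ` with `v_w(ζ − 1) = 1`,
  `v_w(ζ^N − 1) < 1` — precisely the hypothesis shape of `…WildCarrier.exists_character_pow_eq_one_of_level` (`γ = 1`).
* §4 the CM rows (`L` CM, `F = L⁺`, `c` = complex conjugation): the same at every place `v` of `L⁺` unramified in `L` and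
  inert, for every prime `ℓ ∣ q_v + 1`; THE END's CASE `N = 3`: every inert `v` with `q_v ≡ 2 (mod 3)`.

Picture for an auditor of the END rows `hD1''` ∕ `hD3` (our bookkeeping, not a claim about Liu's objects): together with
`…TorsionCarrier` (`ζ_m ∈ E`), `…WildCarrier` (`w ∣ N`) and `…DetCarrier` (split `w`), the det-line device for the `μ`-ALONE
separation of [Lem. D.1 (3)] AS PRINTED is now available at every INERT place `w ∤ N` with `gcd(N, q_v + 1) > 1` of ANY quadratic
`E/F`; the sequel `…InertCarrier` turns the witness into the carrier character and the joint «(1) ∧ (3)» certificate.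

What this does NOT give: the converse at inert tame places (`gcd(N, q_v(q_v + 1)) = 1 ⇒ E_w¹ = (E_w¹)^N`, which needs Hensel's
lemma in `E_w`); ramified non-split places; anything about the rows' OWN carriers `𝓢.omegaLoc v`; Lem. D.1 itself.  HC_CM is NOT
proved.

## v2 addendum (append-only; §§1–4 unchanged)

* §5 the residue NORM-ONE group at an inert place: `mul_smul_sub_pow_card_succ_mem` (`u · (c • u) ≡ u^{q_v + 1} (mod 𝔭_w)`: modulo an
  inert place the norm is the `(q_v + 1)`-th power), `pow_card_succ_sub_one_mem` (global norm-one integers reduce into the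
  `(q_v + 1)`-torsion of `κ(w)ˣ`), **`card_residue_pow_card_succ_eq_one`** (`#κ(w)¹ = #{x ∈ κ(w)ˣ : x^{q_v + 1} = 1} = q_v + 1` — the
  number the siblings' «governed by `gcd(N, |κ_w¹|)`» refers to; `κ(w)ˣ` cyclic of order `(q_v + 1)(q_v − 1)`), and the residue HILBERT 90
  realised by global integers **`exists_mul_mk_smul_eq_mk_of_pow_card_succ_eq_one`** (every `x ∈ κ(w)¹` is the class of `u / c(u)` for some
  `u ∈ 𝓞_E ∖ 𝔭_w`), and the residue step of the converse `exists_pow_eq_of_coprime_card_succ` (`N` coprime to `q_v + 1` ⇒ `κ(w)¹ = (κ(w)¹)^N`).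
  A private lemma records the cyclic-group count (`x^d = 1 ↔ x` is an `m`-th power, exactly `d` solutions, in a cyclic group of order `d m`).
  Still NOT given: the passage from `κ(w)¹` to `E_w¹ ∕ (E_w¹)^N` (Hensel in `E_w`, tree `AdicCompletionHensel` ∕ `AdicCompletionResidueField`),
  i.e. the converse «no det-line carrier» at tame inert places with `gcd(N, q_v(q_v + 1)) = 1`.

Cell pub-hodgecm2 (COR-CM), audit class of the END rows `hD1''` ∕ `hD3`; seat prover-pub-hodgecm2-b10.

References: [Liu2021] Y. Liu, *Fourier–Jacobi cycles and arithmetic relative trace formula*, Camb. J. Math. 9 (2021) =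
arXiv:2102.11518, App. D §D.1 Steps 2–3 (l. 5219–5221), Lemma D.1 (3) (l. 5233); [NeukirchANT1999] J. Neukirch, *Algebraic Number
Theory*, Grundlehren 322 (1999), Ch. I §8 Prop. (8.2) (fundamental identity), Ch. I §9 Prop. (9.4) (`G_𝔓 → G(κ(𝔓)|κ(𝔭))` onto),
Def. (9.5) ∕ Prop. (9.6) (`#I_𝔓 = e`, `I_𝔓 = 1 ⟺ 𝔭` unramified), §9 Exercise 2 (the Frobenius automorphism `φ_𝔓 a ≡ a^q mod 𝔓`),
Ch. I §10 (roots of unity modulo `𝔭`), Ch. IV §3 Thm. (3.5) (Hilbert 90); [CasselsFrohlichANT1967] Ch. VII §1.1 (action of the Galois group on primes and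
valuations).
-/

noncomputable section

open scoped Pointwise
open NumberField IsDedekindDomain

namespace Literature.NumberTheory.Automorphic.Liu2021.LemD1IndexedNonVacuityInertFrobenius

open UnitaryGroup

/-! ## §1 Generalities on a quadratic extension `E/F` of number fields with non-trivial automorphism `c` -/

section Quadratic

variable {F : Type} (E : Type) [Field F] [NumberField F] [Field E] [NumberField E] [Algebra F E]
  [Algebra.IsQuadraticExtension F E] (c : E ≃ₐ[F] E)

variable (v : HeightOneSpectrum (𝓞 F))

omit [NumberField F] [Algebra.IsQuadraticExtension F E] in
/-- **at a NON-SPLIT place `w = c • w` the `w`-adic valuation is `c`-invariant**: `v_w(c x) = v_w(x)` (`v_{c w}(c x) = v_w(x)`,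
tree `HeightOneSpectrum.valuation_algEquiv_smul`). [cite: CasselsFrohlichANT1967, Ch. VII §1.1] -/
theorem valuation_conj_of_smul_eq (w : PlacesOver E v) (hw : c • w.1 = w.1) (x : E) :
    w.1.valuation E (c x) = w.1.valuation E x := by
  have h := HeightOneSpectrum.valuation_algEquiv_smul (F := F) c w.1 x
  rwa [hw] at h

omit [NumberField F] [NumberField E] [Algebra.IsQuadraticExtension F E] in
/-- at a non-split place, `c • u ∈ 𝔭_w ↔ u ∈ 𝔭_w` for `u ∈ 𝓞_E`. [cite: CasselsFrohlichANT1967, Ch. VII §1.1] -/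
theorem smul_mem_asIdeal_iff_of_smul_eq (w : PlacesOver E v) (hw : c • w.1 = w.1) (u : 𝓞 E) :
    c • u ∈ w.1.asIdeal ↔ u ∈ w.1.asIdeal := by
  have h := HeightOneSpectrum.smul_mem_smul_asIdeal_iff c w.1 u
  rwa [hw] at h

omit [NumberField F] [NumberField E] [Algebra.IsQuadraticExtension F E] in
/-- `c` lies in the decomposition group (stabiliser) of `𝔭_w` when `c • w = w`. [cite: NeukirchANT1999, Ch. I §9 Def. (9.5)] -/
theorem mem_stabilizer_of_smul_eq (w : PlacesOver E v) (hw : c • w.1 = w.1) :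
    c ∈ MulAction.stabilizer (E ≃ₐ[F] E) w.1.asIdeal := by
  rw [MulAction.mem_stabilizer_iff]
  exact congrArg HeightOneSpectrum.asIdeal hw

/-! ## §2 The Frobenius congruence at an inert place -/

/-- **`#κ(w) = q_v²` at an inert place**: for `v` unramified in `E` and `w ∣ v` fixed by `c ≠ 1`, `f(w|v) = 2` (tree
`…InertCofinite.inertiaDeg_eq_two_of_smul_eq_of_isUnramifiedIn`) and `#(𝓞_E ∕ 𝔭_w) = #(𝓞_F ∕ 𝔭_v)^{f}` (Mathlib
`Ideal.absNorm_pow_inertiaDeg`). [cite: NeukirchANT1999, Ch. I §8 Prop. (8.2)] -/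
theorem card_residueField_eq_sq (hc : c ≠ 1) (hv : Algebra.IsUnramifiedIn (𝓞 E) v.asIdeal) (w : PlacesOver E v)
    (hw : c • w.1 = w.1) : Nat.card (𝓞 E ⧸ w.1.asIdeal) = Nat.card (𝓞 F ⧸ v.asIdeal) ^ 2 := by
  haveI := PlacesOver.liesOver (E := E) w
  have h := Ideal.absNorm_pow_inertiaDeg v.asIdeal w.1.asIdeal
  rw [LemD1IndexedNonVacuityInertCofinite.inertiaDeg_eq_two_of_smul_eq_of_isUnramifiedIn E c hc v hv w hw,
    Ideal.absNorm_apply, Ideal.absNorm_apply, Submodule.cardQuot_apply, Submodule.cardQuot_apply] at h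
  exact h.symm

/-- `1 < q_v`: the residue ring of a finite place is a non-trivial finite ring. [cite: NeukirchANT1999, Ch. I §8 Prop. (8.2)] -/
theorem one_lt_card_residueField : 1 < Nat.card (𝓞 F ⧸ v.asIdeal) := by
  haveI : v.asIdeal.IsMaximal := v.isMaximal
  haveI : Nontrivial (𝓞 F ⧸ v.asIdeal) := Ideal.Quotient.nontrivial_iff.mpr v.isPrime.ne_top
  exact Finite.one_lt_card

/-- **THE FROBENIUS CONGRUENCE AT AN INERT PLACE.**  Let `E/F` be a quadratic extension of number fields with non-trivial
automorphism `c`, `v` a place of `F` UNRAMIFIED in `E`, and `w ∣ v` a place with `c • w = w`.  Then for every `u ∈ 𝓞_E`,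
`c • u − u^{q_v} ∈ 𝔭_w`, `q_v = #(𝓞_F ∕ 𝔭_v)`: the automorphism of `κ(w) = 𝓞_E ∕ 𝔭_w` induced by `c` is the `q_v`-power
Frobenius.  PROOF: the decomposition group of `𝔭_w` maps onto `G(κ(w)|κ(v))` with kernel the inertia group, of order
`e(w|v) = 1`; so the image of `c ≠ 1` is a non-trivial element of `G(κ(w)|κ(v))`, which is the group of the
`[κ(w) : κ(v)] = f(w|v) = 2` powers of the Frobenius. [cite: NeukirchANT1999, Ch. I §9 Prop. (9.4), Prop. (9.6) and Exercise 2] -/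
theorem smul_sub_pow_card_mem (hc : c ≠ 1) (hv : Algebra.IsUnramifiedIn (𝓞 E) v.asIdeal) (w : PlacesOver E v)
    (hw : c • w.1 = w.1) (u : 𝓞 E) :
    c • u - u ^ Nat.card (𝓞 F ⧸ v.asIdeal) ∈ w.1.asIdeal := by
  classical
  haveI := PlacesOver.liesOver (E := E) w
  haveI : v.asIdeal.IsMaximal := v.isMaximal
  haveI : w.1.asIdeal.IsMaximal := w.1.isMaximal
  letI : Field (𝓞 F ⧸ v.asIdeal) := Ideal.Quotient.field _
  letI : Field (𝓞 E ⧸ w.1.asIdeal) := Ideal.Quotient.field _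
  haveI : IsGaloisGroup (E ≃ₐ[F] E) (𝓞 F) (𝓞 E) := IsGaloisGroup.of_isFractionRing _ _ _ F E
  haveI : Algebra.IsUnramifiedAt (𝓞 F) w.1.asIdeal := hv w.1.asIdeal w.1.isPrime ‹_›
  letI : Fintype (𝓞 F ⧸ v.asIdeal) := Fintype.ofFinite _
  -- `e(w|v) = 1`
  have hev : v.asIdeal.ramificationIdxIn (𝓞 E) = 1 := by
    rw [Ideal.ramificationIdxIn_eq_ramificationIdx v.asIdeal w.1.asIdeal (E ≃ₐ[F] E)]
    exact Ideal.ramificationIdx_eq_one_of_isUnramifiedAt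
  -- the decomposition group injects into the Galois group of the residue extension (inertia has order `e = 1`)
  have hinj : Function.Injective (Ideal.Quotient.stabilizerHom w.1.asIdeal v.asIdeal (E ≃ₐ[F] E)) := by
    have h1 : (Ideal.Quotient.stabilizerHom w.1.asIdeal v.asIdeal (E ≃ₐ[F] E)).ker.map (Subgroup.subtype _) = ⊥ := by
      rw [Ideal.Quotient.map_ker_stabilizer_subtype]
      apply Subgroup.eq_bot_of_card_eq
      rw [Ideal.card_inertia_eq_ramificationIdxIn (G := E ≃ₐ[F] E) v.asIdeal w.1.asIdeal, hev]
    exact (MonoidHom.ker_eq_bot_iff _).mp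
      ((Subgroup.map_eq_bot_iff_of_injective _ (Subgroup.subtype_injective _)).mp h1)
  -- the image `c̄` of `c`
  set cbar := Ideal.Quotient.stabilizerHom w.1.asIdeal v.asIdeal (E ≃ₐ[F] E) ⟨c, mem_stabilizer_of_smul_eq E c v w hw⟩
    with hcbar
  have hcbar1 : cbar ≠ 1 := by
    intro h
    apply hc
    have h2 := hinj (h.trans (map_one (Ideal.Quotient.stabilizerHom w.1.asIdeal v.asIdeal (E ≃ₐ[F] E))).symm)
    exact congrArg Subtype.val h2
  -- `[κ(w) : κ(v)] = f(w|v) = 2`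
  have hfin : Module.finrank (𝓞 F ⧸ v.asIdeal) (𝓞 E ⧸ w.1.asIdeal) = 2 := by
    rw [← Ideal.inertiaDeg_eq_of_isMaximal v.asIdeal w.1.asIdeal]
    exact LemD1IndexedNonVacuityInertCofinite.inertiaDeg_eq_two_of_smul_eq_of_isUnramifiedIn E c hc v hv w hw
  -- `c̄` is a power `Frob^n`, `n < 2`, and `n ≠ 0`
  obtain ⟨⟨n, hn⟩, hfrob⟩ :=
    (FiniteField.bijective_frobeniusAlgEquivOfAlgebraic_pow (𝓞 F ⧸ v.asIdeal) (𝓞 E ⧸ w.1.asIdeal)).2 cbar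
  dsimp only at hfrob
  have hn2 : n < 2 := hfin ▸ hn
  have hn0 : n ≠ 0 := by
    rintro rfl
    rw [pow_zero] at hfrob
    exact hcbar1 hfrob.symm
  have hn1 : n = 1 := by omega
  subst hn1
  rw [pow_one] at hfrob
  -- read off the congruence
  have key : cbar (Ideal.Quotient.mk w.1.asIdeal u) =
      (Ideal.Quotient.mk w.1.asIdeal u) ^ Fintype.card (𝓞 F ⧸ v.asIdeal) := by
    rw [← hfrob, FiniteField.coe_frobeniusAlgEquivOfAlgebraic]
  rw [hcbar, Ideal.Quotient.stabilizerHom_apply, Subgroup.mk_smul, Fintype.card_eq_nat_card, ← map_pow] at key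
  exact Ideal.Quotient.eq.1 key

/-- **non-split unramified places are NOT in the inertia of `c`**: there is `u ∈ 𝓞_E` with `c • u − u ∉ 𝔭_w` (the residue
automorphism `c̄ = Frob_{q_v}` is non-trivial on `κ(w) ⊋ κ(v)`: take `u` with `ū ∉ κ(v)`, i.e. `ū^{q_v} ≠ ū`).
[cite: NeukirchANT1999, Ch. I §9 Prop. (9.6)] -/
theorem exists_smul_sub_not_mem (hc : c ≠ 1) (hv : Algebra.IsUnramifiedIn (𝓞 E) v.asIdeal) (w : PlacesOver E v)
    (hw : c • w.1 = w.1) : ∃ u : 𝓞 E, c • u - u ∉ w.1.asIdeal := by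
  classical
  haveI : w.1.asIdeal.IsMaximal := w.1.isMaximal
  letI : Field (𝓞 E ⧸ w.1.asIdeal) := Ideal.Quotient.field _
  set q := Nat.card (𝓞 F ⧸ v.asIdeal) with hq
  have hq1 : 1 < q := one_lt_card_residueField v
  have hk : Nat.card (𝓞 E ⧸ w.1.asIdeal) = q ^ 2 := card_residueField_eq_sq E c v hc hv w hw
  -- a generator of `κ(w)ˣ`, of order `q² − 1 > q − 1`
  obtain ⟨g, hg⟩ := IsCyclic.exists_ofOrder_eq_natCard (α := (𝓞 E ⧸ w.1.asIdeal)ˣ)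
  rw [Nat.card_units, hk] at hg
  have hgq : g ^ (q - 1) ≠ 1 := by
    refine pow_ne_one_of_lt_orderOf (by omega) ?_
    rw [hg]
    have : q - 1 < q ^ 2 - 1 := by
      have : q < q ^ 2 := by nlinarith
      omega
    exact this
  obtain ⟨u, hu⟩ := Ideal.Quotient.mk_surjective ((g : (𝓞 E ⧸ w.1.asIdeal)ˣ) : 𝓞 E ⧸ w.1.asIdeal)
  refine ⟨u, fun hmem => hgq ?_⟩
  -- `c • u ≡ u^q` and `c • u ≡ u` give `g^q = g`
  have h1 : Ideal.Quotient.mk w.1.asIdeal (c • u) = Ideal.Quotient.mk w.1.asIdeal u := Ideal.Quotient.eq.2 hmem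
  have h2 : Ideal.Quotient.mk w.1.asIdeal (c • u) = (Ideal.Quotient.mk w.1.asIdeal u) ^ q := by
    rw [← map_pow]
    exact Ideal.Quotient.eq.2 (smul_sub_pow_card_mem E c v hc hv w hw u)
  rw [h1, hu, ← Units.val_pow_eq_pow_val] at h2
  have h3 : g = g ^ q := Units.ext h2
  have hq' : q = (q - 1) + 1 := by omega
  rw [hq', pow_succ] at h3
  exact (mul_eq_right.1 h3.symm)

/-! ## §3 The inert torsion witness -/

/-- **residue classes of order `ℓ` among the `u / c(u)`**: for `v` unramified in `E`, `w ∣ v` fixed by `c ≠ 1` and a prime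
`ℓ ∣ q_v + 1`, there is `u ∈ 𝓞_E` with `u ∉ 𝔭_w`, `u − c • u ∉ 𝔭_w` and `u^ℓ − (c • u)^ℓ ∈ 𝔭_w` (so `u / c(u)` has order
exactly `ℓ` in `κ(w)ˣ`).  PROOF: `κ(w)ˣ` is cyclic of order `q_v² − 1`; for a generator `g`, `ū = g^{(q_v + 1)/ℓ}` has
`ū^{q_v − 1} = g^{(q_v² − 1)/ℓ} ≠ 1` and `ū^{(q_v − 1)ℓ} = 1`, and `c • u ≡ ū^{q_v}` (§2).
[cite: NeukirchANT1999, Ch. I §9 Exercise 2 and Ch. I §10 (before Prop. 10.2)] -/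
theorem exists_sub_smul_not_mem_pow_sub_pow_mem (hc : c ≠ 1) (hv : Algebra.IsUnramifiedIn (𝓞 E) v.asIdeal)
    (w : PlacesOver E v) (hw : c • w.1 = w.1) {ℓ : ℕ} (hℓ : ℓ.Prime) (hℓq : ℓ ∣ Nat.card (𝓞 F ⧸ v.asIdeal) + 1) :
    ∃ u : 𝓞 E, u ∉ w.1.asIdeal ∧ u - c • u ∉ w.1.asIdeal ∧ u ^ ℓ - (c • u) ^ ℓ ∈ w.1.asIdeal := by
  classical
  haveI : w.1.asIdeal.IsMaximal := w.1.isMaximal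
  letI : Field (𝓞 E ⧸ w.1.asIdeal) := Ideal.Quotient.field _
  set q := Nat.card (𝓞 F ⧸ v.asIdeal) with hq
  have hq1 : 1 < q := one_lt_card_residueField v
  have hk : Nat.card (𝓞 E ⧸ w.1.asIdeal) = q ^ 2 := card_residueField_eq_sq E c v hc hv w hw
  have hℓ2 : 2 ≤ ℓ := hℓ.two_le
  obtain ⟨m, hm⟩ := hℓq
  have hm0 : m ≠ 0 := by
    rintro rfl
    rw [mul_zero] at hm
    omega
  -- arithmetic: `d = m (q − 1)` has `d ℓ = q² − 1`, `0 < d < q² − 1`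
  have hsq : q ^ 2 - 1 = (q + 1) * (q - 1) := by
    have := Nat.sq_sub_sq q 1
    simpa using this
  have hdl : m * (q - 1) * ℓ = q ^ 2 - 1 := by
    rw [hsq, hm]
    ring
  have hd0 : m * (q - 1) ≠ 0 := Nat.mul_ne_zero hm0 (by omega)
  have hdlt : m * (q - 1) < q ^ 2 - 1 := by
    rw [← hdl]
    exact lt_mul_of_one_lt_right (Nat.pos_of_ne_zero hd0) (by omega)
  -- a generator of `κ(w)ˣ`
  obtain ⟨g, hg⟩ := IsCyclic.exists_ofOrder_eq_natCard (α := (𝓞 E ⧸ w.1.asIdeal)ˣ)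
  rw [Nat.card_units, hk] at hg
  have hgd : g ^ (m * (q - 1)) ≠ 1 := pow_ne_one_of_lt_orderOf hd0 (by rw [hg]; exact hdlt)
  have hgdl : g ^ (m * (q - 1) * ℓ) = 1 := by rw [hdl, ← hg, pow_orderOf_eq_one]
  -- `ū = g^m`
  set ub : (𝓞 E ⧸ w.1.asIdeal)ˣ := g ^ m with hub
  have hub1 : ub ^ (q - 1) ≠ 1 := by rwa [hub, ← pow_mul]
  have hub2 : ub ^ ((q - 1) * ℓ) = 1 := by rw [hub, ← pow_mul, ← mul_assoc]; exact hgdl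
  obtain ⟨u, hu⟩ := Ideal.Quotient.mk_surjective ((ub : (𝓞 E ⧸ w.1.asIdeal)ˣ) : 𝓞 E ⧸ w.1.asIdeal)
  -- `c • u ≡ u^q`
  have hcu : Ideal.Quotient.mk w.1.asIdeal (c • u) = ((ub ^ q : (𝓞 E ⧸ w.1.asIdeal)ˣ) : 𝓞 E ⧸ w.1.asIdeal) := by
    rw [Units.val_pow_eq_pow_val, ← hu, ← map_pow]
    exact Ideal.Quotient.eq.2 (smul_sub_pow_card_mem E c v hc hv w hw u)
  have hq' : q = (q - 1) + 1 := by omega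
  refine ⟨u, ?_, ?_, ?_⟩
  · -- `u ∉ 𝔭_w`
    intro h
    apply ub.ne_zero
    rw [← hu]
    exact Ideal.Quotient.eq_zero_iff_mem.2 h
  · -- `u − c • u ∉ 𝔭_w`: otherwise `ū = ū^q`, `ū^{q−1} = 1`
    intro h
    apply hub1
    have h1 : Ideal.Quotient.mk w.1.asIdeal u = Ideal.Quotient.mk w.1.asIdeal (c • u) := Ideal.Quotient.eq.2 h
    rw [hcu, hu] at h1
    have h3 : ub = ub ^ q := Units.ext h1
    rw [hq', pow_succ] at h3
    exact mul_eq_right.1 h3.symm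
  · -- `u^ℓ − (c • u)^ℓ ∈ 𝔭_w`: `ū^ℓ = ū^{qℓ}` since `ū^{(q−1)ℓ} = 1`
    have hqℓ : q * ℓ = (q - 1) * ℓ + ℓ := by
      conv_lhs => rw [hq']
      ring
    have hfin : (ub ^ q) ^ ℓ = ub ^ ℓ := by
      rw [← pow_mul, hqℓ, pow_add, hub2, one_mul]
    refine Ideal.Quotient.eq.1 ?_
    rw [map_pow, map_pow, hcu, hu, ← Units.val_pow_eq_pow_val, ← Units.val_pow_eq_pow_val, hfin]

/-- `v_w(y^k − 1) ≤ v_w(y − 1)` for `v_w(y) ≤ 1` (`y^k − 1 = (y − 1) Σ_{i<k} y^i`). [cite: NeukirchANT1999, Ch. II §3 Prop. (3.10)] -/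
theorem valuation_pow_sub_one_le (w : HeightOneSpectrum (𝓞 E)) {y : E} (hy : w.valuation E y ≤ 1) (k : ℕ) :
    w.valuation E (y ^ k - 1) ≤ w.valuation E (y - 1) := by
  rw [← geom_sum_mul, Valuation.map_mul]
  have hS : w.valuation E (∑ j ∈ Finset.range k, y ^ j) ≤ 1 :=
    Valuation.map_sum_le _ fun j _ => by rw [Valuation.map_pow]; exact pow_le_one' hy _
  exact mul_le_of_le_one_left' hS

/-- **THE INERT TORSION WITNESS.**  Let `E/F` be a quadratic extension of number fields with non-trivial automorphism `c`,
`v` a place of `F` unramified in `E`, `w ∣ v` with `c • w = w`, and `ℓ` a prime dividing `q_v + 1`.  Then there is a GLOBAL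
norm-one element `ζ ∈ E` — `ζ · c(ζ) = 1` — with `v_w(ζ − 1) = 1` and `v_w(ζ^ℓ − 1) < 1`: the class of `ζ` in `κ(w)ˣ` is a
non-trivial `ℓ`-torsion element (of the norm-one subgroup `κ(w)¹`, cyclic of order `q_v + 1`).  Namely `ζ = u / c(u)` for the
`u` of `exists_sub_smul_not_mem_pow_sub_pow_mem`; `ζ · c(ζ) = 1` because `c² = 1` (tree
`HeckeCharacter.CMQuadraticExtension.mul_self_eq_one`).
[cite: NeukirchANT1999, Ch. I §9 Exercise 2 and Ch. I §10 (before Prop. 10.2)] [cite: Liu2021, App. D §D.1 Step 3 (l. 5221)] -/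
theorem exists_norm_one_inert_witness (hc : c ≠ 1) (hv : Algebra.IsUnramifiedIn (𝓞 E) v.asIdeal) (w : PlacesOver E v)
    (hw : c • w.1 = w.1) {ℓ : ℕ} (hℓ : ℓ.Prime) (hℓq : ℓ ∣ Nat.card (𝓞 F ⧸ v.asIdeal) + 1) :
    ∃ ζ : E, ζ * c ζ = 1 ∧ w.1.valuation E ζ = 1 ∧ w.1.valuation E (ζ - 1) = 1 ∧ w.1.valuation E (ζ ^ ℓ - 1) < 1 := by
  obtain ⟨u, hu, hu1, hu2⟩ := exists_sub_smul_not_mem_pow_sub_pow_mem E c v hc hv w hw hℓ hℓq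
  have hval : ∀ x : 𝓞 E, w.1.valuation E (x : E) = w.1.intValuation x := fun x => by
    rw [RingOfIntegers.coe_eq_algebraMap, HeightOneSpectrum.valuation_of_algebraMap]
  set a : E := (u : E) with ha
  set b : E := ((c • u : 𝓞 E) : E) with hb
  have hbc : b = c a := rfl
  have hva : w.1.valuation E a = 1 := by rw [ha, hval, HeightOneSpectrum.intValuation_eq_one_iff]; exact hu
  have hcu : c • u ∉ w.1.asIdeal := fun h => hu ((smul_mem_asIdeal_iff_of_smul_eq E c v w hw u).1 h)
  have hvb : w.1.valuation E b = 1 := by rw [hb, hval, HeightOneSpectrum.intValuation_eq_one_iff]; exact hcu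
  have hvab : w.1.valuation E (a - b) = 1 := by
    have : a - b = ((u - c • u : 𝓞 E) : E) := by rw [ha, hb]; push_cast; rfl
    rw [this, hval, HeightOneSpectrum.intValuation_eq_one_iff]
    exact hu1
  have hvabl : w.1.valuation E (a ^ ℓ - b ^ ℓ) < 1 := by
    have : a ^ ℓ - b ^ ℓ = ((u ^ ℓ - (c • u) ^ ℓ : 𝓞 E) : E) := by rw [ha, hb]; push_cast; rfl
    rw [this, hval, HeightOneSpectrum.intValuation_lt_one_iff_mem]
    exact hu2
  have ha0 : a ≠ 0 := fun h => by rw [h, map_zero] at hva; exact zero_ne_one hva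
  have hb0 : b ≠ 0 := fun h => by rw [h, map_zero] at hvb; exact zero_ne_one hvb
  have hcc : c * c = 1 :=
    Literature.NumberTheory.GaloisRepresentations.HeckeCharacter.CMQuadraticExtension.mul_self_eq_one c
      (Algebra.IsQuadraticExtension.finrank_eq_two F E) hc
  have hcb : c b = a := by rw [hbc, ← AlgEquiv.mul_apply, hcc, AlgEquiv.one_apply]
  refine ⟨a * b⁻¹, ?_, ?_, ?_, ?_⟩
  · rw [map_mul, map_inv₀, hcb, ← hbc]
    calc a * b⁻¹ * (b * a⁻¹) = (a * a⁻¹) * (b * b⁻¹) := by ring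
      _ = 1 := by rw [mul_inv_cancel₀ ha0, mul_inv_cancel₀ hb0, one_mul]
  · rw [map_mul, map_inv₀, hva, hvb, inv_one, mul_one]
  · have hrw : a * b⁻¹ - 1 = (a - b) * b⁻¹ := by rw [sub_mul, mul_inv_cancel₀ hb0]
    rw [hrw, map_mul, map_inv₀, hvab, hvb, inv_one, mul_one]
  · have hrw : (a * b⁻¹) ^ ℓ - 1 = (a ^ ℓ - b ^ ℓ) * (b ^ ℓ)⁻¹ := by
      rw [sub_mul, mul_inv_cancel₀ (pow_ne_zero _ hb0), mul_pow, inv_pow]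
    rw [hrw, map_mul, map_inv₀, map_pow, hvb, one_pow, inv_one, mul_one]
    exact hvabl

/-- **… `N`-form**: for every `N` NOT coprime to `q_v + 1` there is a global norm-one `ζ ∈ E` with `v_w(ζ) = 1`, `v_w(ζ − 1) = 1`
and `v_w(ζ^N − 1) < 1` (take a prime `ℓ ∣ gcd(N, q_v + 1)` and the witness for `ℓ`; `v_w(ζ^N − 1) ≤ v_w(ζ^ℓ − 1)`).  This is
exactly the hypothesis shape `v_w(ζ^N − 1) < v_w(ζ − 1) = γ` of `…WildCarrier.exists_character_pow_eq_one_of_level`, with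
level `γ = 1`. [cite: NeukirchANT1999, Ch. I §9 Exercise 2 and Ch. I §10 (before Prop. 10.2)] [cite: Liu2021, App. D §D.1 Step 3 (l. 5221)] -/
theorem exists_norm_one_inert_witness_of_not_coprime (hc : c ≠ 1) (hv : Algebra.IsUnramifiedIn (𝓞 E) v.asIdeal)
    (w : PlacesOver E v) (hw : c • w.1 = w.1) {N : ℕ} (hN : ¬ Nat.Coprime N (Nat.card (𝓞 F ⧸ v.asIdeal) + 1)) :
    ∃ ζ : E, ζ * c ζ = 1 ∧ w.1.valuation E ζ = 1 ∧ w.1.valuation E (ζ - 1) = 1 ∧ w.1.valuation E (ζ ^ N - 1) < 1 := by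
  obtain ⟨ℓ, hℓ, hℓd⟩ := Nat.exists_prime_and_dvd hN
  have hℓN : ℓ ∣ N := hℓd.trans (Nat.gcd_dvd_left _ _)
  have hℓq : ℓ ∣ Nat.card (𝓞 F ⧸ v.asIdeal) + 1 := hℓd.trans (Nat.gcd_dvd_right _ _)
  obtain ⟨ζ, hζc, hζ, hζ1, hζℓ⟩ := exists_norm_one_inert_witness E c v hc hv w hw hℓ hℓq
  obtain ⟨k, rfl⟩ := hℓN
  refine ⟨ζ, hζc, hζ, hζ1, ?_⟩
  rw [pow_mul]
  exact (valuation_pow_sub_one_le E w.1 (by rw [Valuation.map_pow, hζ, one_pow]) k).trans_lt hζℓ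

/-- **THE END's rank `N = 3`**: at every inert place with `q_v ≡ 2 (mod 3)` (i.e. `3 ∣ q_v + 1`) a global norm-one `ζ` with
`v_w(ζ − 1) = 1`, `v_w(ζ³ − 1) < 1`. [cite: NeukirchANT1999, Ch. I §9 Exercise 2] [cite: Liu2021, App. D §D.1 Step 3 (l. 5221)] -/
theorem exists_norm_one_inert_witness_three (hc : c ≠ 1) (hv : Algebra.IsUnramifiedIn (𝓞 E) v.asIdeal)
    (w : PlacesOver E v) (hw : c • w.1 = w.1) (h3 : 3 ∣ Nat.card (𝓞 F ⧸ v.asIdeal) + 1) :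
    ∃ ζ : E, ζ * c ζ = 1 ∧ w.1.valuation E ζ = 1 ∧ w.1.valuation E (ζ - 1) = 1 ∧ w.1.valuation E (ζ ^ 3 - 1) < 1 :=
  exists_norm_one_inert_witness E c v hc hv w hw Nat.prime_three h3

end Quadratic

/-! ## §4 The CM rows: `L` CM, `F = L⁺`, `c` = complex conjugation -/

section CM

variable (L : Type) [Field L] [NumberField L] [IsCMField L] (v : HeightOneSpectrum (𝓞 (maximalRealSubfield L)))

/-- **CM form of the Frobenius congruence**: at a place `v` of `L⁺` unramified in `L` and a place `w ∣ v` fixed by complex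
conjugation, `ū ↦ \bar u` is the `q_v`-Frobenius of `κ(w)`: `\bar u − u^{q_v} ∈ 𝔭_w`. [cite: NeukirchANT1999, Ch. I §9 Exercise 2] -/
theorem complexConj_smul_sub_pow_card_mem (hv : Algebra.IsUnramifiedIn (𝓞 L) v.asIdeal) (w : PlacesOver L v)
    (hw : IsCMField.complexConj L • w.1 = w.1) (u : 𝓞 L) :
    IsCMField.complexConj L • u - u ^ Nat.card (𝓞 (maximalRealSubfield L) ⧸ v.asIdeal) ∈ w.1.asIdeal :=
  smul_sub_pow_card_mem L (IsCMField.complexConj L) v (IsCMField.complexConj_ne_one L) hv w hw u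

/-- **CM form of the inert torsion witness**: `L` CM, `v` a place of `L⁺` unramified in `L`, `w ∣ v` fixed by complex conjugation,
`ℓ` a prime with `ℓ ∣ q_v + 1`: a global `ζ ∈ L` with `ζ \bar ζ = 1`, `v_w(ζ) = 1`, `v_w(ζ − 1) = 1`, `v_w(ζ^ℓ − 1) < 1`.
[cite: NeukirchANT1999, Ch. I §9 Exercise 2] [cite: Liu2021, App. D §D.1 Step 3 (l. 5221)] -/
theorem exists_norm_one_inert_witness_of_isCMField (hv : Algebra.IsUnramifiedIn (𝓞 L) v.asIdeal) (w : PlacesOver L v)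
    (hw : IsCMField.complexConj L • w.1 = w.1) {ℓ : ℕ} (hℓ : ℓ.Prime)
    (hℓq : ℓ ∣ Nat.card (𝓞 (maximalRealSubfield L) ⧸ v.asIdeal) + 1) :
    ∃ ζ : L, ζ * IsCMField.complexConj L ζ = 1 ∧ w.1.valuation L ζ = 1 ∧ w.1.valuation L (ζ - 1) = 1 ∧
      w.1.valuation L (ζ ^ ℓ - 1) < 1 :=
  exists_norm_one_inert_witness L (IsCMField.complexConj L) v (IsCMField.complexConj_ne_one L) hv w hw hℓ hℓq

/-- **CM `N`-form**: for every `N` not coprime to `q_v + 1`. [cite: NeukirchANT1999, Ch. I §9 Exercise 2] [cite: Liu2021, App. D §D.1 Step 3 (l. 5221)] -/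
theorem exists_norm_one_inert_witness_of_isCMField_of_not_coprime (hv : Algebra.IsUnramifiedIn (𝓞 L) v.asIdeal)
    (w : PlacesOver L v) (hw : IsCMField.complexConj L • w.1 = w.1) {N : ℕ}
    (hN : ¬ Nat.Coprime N (Nat.card (𝓞 (maximalRealSubfield L) ⧸ v.asIdeal) + 1)) :
    ∃ ζ : L, ζ * IsCMField.complexConj L ζ = 1 ∧ w.1.valuation L ζ = 1 ∧ w.1.valuation L (ζ - 1) = 1 ∧
      w.1.valuation L (ζ ^ N - 1) < 1 :=
  exists_norm_one_inert_witness_of_not_coprime L (IsCMField.complexConj L) v (IsCMField.complexConj_ne_one L) hv w hw hN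

/-- **THE END's rank `3`, CM form**: every inert place of `L⁺` (unramified in `L`) with `q_v ≡ 2 (mod 3)`.
[cite: NeukirchANT1999, Ch. I §9 Exercise 2] [cite: Liu2021, App. D §D.1 Step 3 (l. 5221)] -/
theorem exists_norm_one_inert_witness_of_isCMField_three (hv : Algebra.IsUnramifiedIn (𝓞 L) v.asIdeal)
    (w : PlacesOver L v) (hw : IsCMField.complexConj L • w.1 = w.1)
    (h3 : 3 ∣ Nat.card (𝓞 (maximalRealSubfield L) ⧸ v.asIdeal) + 1) :
    ∃ ζ : L, ζ * IsCMField.complexConj L ζ = 1 ∧ w.1.valuation L ζ = 1 ∧ w.1.valuation L (ζ - 1) = 1 ∧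
      w.1.valuation L (ζ ^ 3 - 1) < 1 :=
  exists_norm_one_inert_witness L (IsCMField.complexConj L) v (IsCMField.complexConj_ne_one L) hv w hw Nat.prime_three h3

end CM

/-! ## §5 (v2, appended) The residue NORM-ONE group at an inert place: `u · c(u) ≡ u^{q_v + 1} (mod 𝔭_w)`, it has EXACTLY `q_v + 1`
elements, and every element is the class of some `u / c(u)` (Hilbert 90 for `κ(w) | κ(v)` realised by global integers) -/

section ResidueNormOne

variable {F : Type} (E : Type) [Field F] [NumberField F] [Field E] [NumberField E] [Algebra F E]
  [Algebra.IsQuadraticExtension F E] (c : E ≃ₐ[F] E) (v : HeightOneSpectrum (𝓞 F))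

/-- **the norm is the `(q_v + 1)`-th power modulo an inert place**: `u · (c • u) − u^{q_v + 1} ∈ 𝔭_w` for every `u ∈ 𝓞_E` (`c • u ≡ u^{q_v}`).
[cite: NeukirchANT1999, Ch. I §9 Exercise 2] -/
theorem mul_smul_sub_pow_card_succ_mem (hc : c ≠ 1) (hv : Algebra.IsUnramifiedIn (𝓞 E) v.asIdeal) (w : PlacesOver E v)
    (hw : c • w.1 = w.1) (u : 𝓞 E) :
    u * (c • u) - u ^ (Nat.card (𝓞 F ⧸ v.asIdeal) + 1) ∈ w.1.asIdeal := by
  have h := Ideal.mul_mem_left w.1.asIdeal u (smul_sub_pow_card_mem E c v hc hv w hw u)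
  have hrw : u * (c • u) - u ^ (Nat.card (𝓞 F ⧸ v.asIdeal) + 1) = u * (c • u - u ^ Nat.card (𝓞 F ⧸ v.asIdeal)) := by ring
  rwa [hrw]

/-- **global norm-one integers reduce into the `(q_v + 1)`-torsion of `κ(w)ˣ`**: if `u · (c • u) − 1 ∈ 𝔭_w` (in particular if
`u · c(u) = 1`) then `u^{q_v + 1} − 1 ∈ 𝔭_w`. [cite: NeukirchANT1999, Ch. I §9 Exercise 2] -/
theorem pow_card_succ_sub_one_mem (hc : c ≠ 1) (hv : Algebra.IsUnramifiedIn (𝓞 E) v.asIdeal) (w : PlacesOver E v)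
    (hw : c • w.1 = w.1) (u : 𝓞 E) (hu : u * (c • u) - 1 ∈ w.1.asIdeal) :
    u ^ (Nat.card (𝓞 F ⧸ v.asIdeal) + 1) - 1 ∈ w.1.asIdeal := by
  have h := w.1.asIdeal.sub_mem hu (mul_smul_sub_pow_card_succ_mem E c v hc hv w hw u)
  have hrw : u * (c • u) - 1 - (u * (c • u) - u ^ (Nat.card (𝓞 F ⧸ v.asIdeal) + 1)) = u ^ (Nat.card (𝓞 F ⧸ v.asIdeal) + 1) - 1 := by
    ring
  rwa [hrw] at h

/-- in a finite cyclic group of order `d · m` (`d, m ≠ 0`): `x ^ d = 1 ↔ x` is an `m`-th power, and there are exactly `d` such `x`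
(the `d`-torsion is the cyclic subgroup generated by `g^m` for a generator `g`). [folklore] -/
private theorem pow_eq_one_iff_and_card_of_isCyclic {G : Type*} [CommGroup G] [Finite G] [IsCyclic G] {d m : ℕ}
    (hcard : Nat.card G = d * m) (hd : d ≠ 0) (hm : m ≠ 0) :
    (∀ x : G, x ^ d = 1 ↔ ∃ y : G, y ^ m = x) ∧ Nat.card {x : G // x ^ d = 1} = d := by
  classical
  obtain ⟨g, hg⟩ := IsCyclic.exists_ofOrder_eq_natCard (α := G)
  rw [hcard] at hg
  -- `g` generates: every `x` is `g ^ k`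
  have hgen : ∀ x : G, ∃ k : ℕ, g ^ k = x := fun x => by
    have htop : Subgroup.zpowers g = ⊤ := by
      apply Subgroup.eq_top_of_card_eq
      rw [Nat.card_zpowers, hg, hcard]
    have hx : x ∈ Subgroup.zpowers g := by rw [htop]; exact Subgroup.mem_top x
    rw [← mem_powers_iff_mem_zpowers, Submonoid.mem_powers_iff] at hx
    exact hx
  -- the backward direction: `(y^m)^d = y^{card} = 1`
  have hback : ∀ y : G, (y ^ m) ^ d = 1 := fun y => by
    rw [← pow_mul, mul_comm, ← hcard]
    exact pow_card_eq_one'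
  -- the forward direction: `g^(kd) = 1 ⇒ d m ∣ k d ⇒ m ∣ k`
  have hfwd : ∀ x : G, x ^ d = 1 → ∃ j : ℕ, (g ^ j) ^ m = x := fun x hx => by
    obtain ⟨k, rfl⟩ := hgen x
    rw [← pow_mul] at hx
    have hdvd : d * m ∣ k * d := by rw [← hg]; exact orderOf_dvd_of_pow_eq_one hx
    rw [mul_comm k d] at hdvd
    obtain ⟨j, rfl⟩ := (Nat.mul_dvd_mul_iff_left (Nat.pos_of_ne_zero hd)).1 hdvd
    exact ⟨j, by rw [← pow_mul, mul_comm]⟩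
  refine ⟨fun x => ⟨fun hx => ?_, ?_⟩, ?_⟩
  · obtain ⟨j, hj⟩ := hfwd x hx
    exact ⟨g ^ j, hj⟩
  · rintro ⟨y, rfl⟩
    exact hback y
  · -- `{x // x^d = 1} ≃ zpowers (g^m)`, of order `orderOf (g^m) = d`
    have hiff : ∀ x : G, x ^ d = 1 ↔ x ∈ Subgroup.zpowers (g ^ m) := fun x => by
      constructor
      · intro hx
        obtain ⟨j, hj⟩ := hfwd x hx
        rw [← mem_powers_iff_mem_zpowers, Submonoid.mem_powers_iff]
        exact ⟨j, by rw [← pow_mul, mul_comm, pow_mul, hj]⟩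
      · intro hx
        rw [← mem_powers_iff_mem_zpowers, Submonoid.mem_powers_iff] at hx
        obtain ⟨j, rfl⟩ := hx
        rw [← pow_mul g m j, mul_comm m j, pow_mul g j m]
        exact hback (g ^ j)
    have hord : orderOf (g ^ m) = d := by
      rw [orderOf_pow_of_dvd hm (by rw [hg]; exact Dvd.intro_left d rfl), hg, Nat.mul_div_cancel _ (Nat.pos_of_ne_zero hm)]
    have hcongr : Nat.card {x : G // x ^ d = 1} = Nat.card (Subgroup.zpowers (g ^ m)) :=
      Nat.card_congr (Equiv.subtypeEquivRight hiff)
    rw [hcongr, Nat.card_zpowers, hord]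

/-- **`#κ(w)¹ = q_v + 1`**: at an inert place (`v` unramified in `E`, `c • w = w`) the elements `x` of `κ(w)ˣ = (𝓞_E ∕ 𝔭_w)ˣ` with
`x^{q_v + 1} = 1` — by `mul_smul_sub_pow_card_succ_mem` exactly the classes `x` with `x · c̄(x) = 1`, the residue NORM-ONE group `κ(w)¹` that
governs `(E_w¹ : (E_w¹)^N)` at tame `w` — are `q_v + 1` in number (`κ(w)ˣ` is cyclic of order `q_v² − 1 = (q_v + 1)(q_v − 1)`).
[cite: NeukirchANT1999, Ch. I §9 Exercise 2 and Ch. I §10 (before Prop. 10.2)] -/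
theorem card_residue_pow_card_succ_eq_one (hc : c ≠ 1) (hv : Algebra.IsUnramifiedIn (𝓞 E) v.asIdeal) (w : PlacesOver E v)
    (hw : c • w.1 = w.1) :
    Nat.card {x : (𝓞 E ⧸ w.1.asIdeal)ˣ // x ^ (Nat.card (𝓞 F ⧸ v.asIdeal) + 1) = 1} = Nat.card (𝓞 F ⧸ v.asIdeal) + 1 := by
  classical
  haveI : w.1.asIdeal.IsMaximal := w.1.isMaximal
  letI : Field (𝓞 E ⧸ w.1.asIdeal) := Ideal.Quotient.field _
  set q := Nat.card (𝓞 F ⧸ v.asIdeal) with hq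
  have hq1 : 1 < q := one_lt_card_residueField v
  have hk : Nat.card (𝓞 E ⧸ w.1.asIdeal)ˣ = (q + 1) * (q - 1) := by
    rw [Nat.card_units, card_residueField_eq_sq E c v hc hv w hw]
    have := Nat.sq_sub_sq q 1
    simpa using this
  exact (pow_eq_one_iff_and_card_of_isCyclic hk (by omega) (by omega)).2

/-- **residue HILBERT 90 realised by global integers**: at an inert place every class `x ∈ κ(w)ˣ` with `x^{q_v + 1} = 1` is the class of
`u / c(u)` for some `u ∈ 𝓞_E`, `u ∉ 𝔭_w`: `x · \overline{c • u} = \bar u` (`x⁻¹` is a `(q_v − 1)`-th power `\bar u^{q_v − 1}` in the cyclic group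
`κ(w)ˣ`, and `\overline{c • u} = \bar u^{q_v}`).  So the residue norm-one group is exactly the set of classes of the global norm-one elements
`u / c(u)` of `exists_norm_one_inert_witness`. [cite: NeukirchANT1999, Ch. I §9 Exercise 2 and Ch. IV §3 (Hilbert 90, Thm. 3.5)] -/
theorem exists_mul_mk_smul_eq_mk_of_pow_card_succ_eq_one (hc : c ≠ 1) (hv : Algebra.IsUnramifiedIn (𝓞 E) v.asIdeal)
    (w : PlacesOver E v) (hw : c • w.1 = w.1) (x : (𝓞 E ⧸ w.1.asIdeal)ˣ)
    (hx : x ^ (Nat.card (𝓞 F ⧸ v.asIdeal) + 1) = 1) :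
    ∃ u : 𝓞 E, u ∉ w.1.asIdeal ∧
      (x : 𝓞 E ⧸ w.1.asIdeal) * Ideal.Quotient.mk w.1.asIdeal (c • u) = Ideal.Quotient.mk w.1.asIdeal u := by
  classical
  haveI : w.1.asIdeal.IsMaximal := w.1.isMaximal
  letI : Field (𝓞 E ⧸ w.1.asIdeal) := Ideal.Quotient.field _
  set q := Nat.card (𝓞 F ⧸ v.asIdeal) with hq
  have hq1 : 1 < q := one_lt_card_residueField v
  have hk : Nat.card (𝓞 E ⧸ w.1.asIdeal)ˣ = (q + 1) * (q - 1) := by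
    rw [Nat.card_units, card_residueField_eq_sq E c v hc hv w hw]
    have := Nat.sq_sub_sq q 1
    simpa using this
  have hx' : x⁻¹ ^ (q + 1) = 1 := by rw [inv_pow, hx, inv_one]
  obtain ⟨y, hy⟩ := ((pow_eq_one_iff_and_card_of_isCyclic hk (by omega) (by omega)).1 x⁻¹).1 hx'
  obtain ⟨u, hu⟩ := Ideal.Quotient.mk_surjective ((y : (𝓞 E ⧸ w.1.asIdeal)ˣ) : 𝓞 E ⧸ w.1.asIdeal)
  refine ⟨u, fun h => y.ne_zero (by rw [← hu]; exact Ideal.Quotient.eq_zero_iff_mem.2 h), ?_⟩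
  have hcu : Ideal.Quotient.mk w.1.asIdeal (c • u) = ((y ^ q : (𝓞 E ⧸ w.1.asIdeal)ˣ) : 𝓞 E ⧸ w.1.asIdeal) := by
    rw [Units.val_pow_eq_pow_val, ← hu, ← map_pow]
    exact Ideal.Quotient.eq.2 (smul_sub_pow_card_mem E c v hc hv w hw u)
  rw [hcu, hu, ← Units.val_mul]
  congr 1
  -- `x * y^q = y` from `y^(q-1) = x⁻¹`
  have hq' : q = (q - 1) + 1 := by omega
  rw [hq', pow_succ, hy, ← mul_assoc, mul_inv_cancel, one_mul]

/-- **the residue step of the CONVERSE**: if `N` is coprime to `q_v + 1 = #κ(w)¹`, every class of the residue norm-one group is an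
`N`-th power INSIDE it (`x^{q_v + 1} = 1 ⇒ x = y^N` with `y^{q_v + 1} = 1`; the `N`-th power map of a finite group of order prime to `N` is a
bijection, Mathlib `Nat.Coprime.pow_left_bijective`).  What is still missing for «no det-line carrier at a tame inert place with
`gcd(N, q_v(q_v + 1)) = 1`» is the lift `κ(w)¹ → E_w¹ ∕ (E_w¹)^N` (Hensel in `E_w`, tree `AdicCompletionHensel` ∕ `AdicCompletionResidueField`).
[cite: NeukirchANT1999, Ch. I §9 Exercise 2 and Ch. II §3 Prop. (3.10)] -/
theorem exists_pow_eq_of_coprime_card_succ (hc : c ≠ 1) (hv : Algebra.IsUnramifiedIn (𝓞 E) v.asIdeal) (w : PlacesOver E v)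
    (hw : c • w.1 = w.1) {N : ℕ} (hN : Nat.Coprime N (Nat.card (𝓞 F ⧸ v.asIdeal) + 1)) (x : (𝓞 E ⧸ w.1.asIdeal)ˣ)
    (hx : x ^ (Nat.card (𝓞 F ⧸ v.asIdeal) + 1) = 1) :
    ∃ y : (𝓞 E ⧸ w.1.asIdeal)ˣ, y ^ (Nat.card (𝓞 F ⧸ v.asIdeal) + 1) = 1 ∧ y ^ N = x := by
  classical
  set q := Nat.card (𝓞 F ⧸ v.asIdeal) with hq
  let H : Subgroup (𝓞 E ⧸ w.1.asIdeal)ˣ := (powMonoidHom (q + 1) : (𝓞 E ⧸ w.1.asIdeal)ˣ →* (𝓞 E ⧸ w.1.asIdeal)ˣ).ker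
  have hmem : ∀ z : (𝓞 E ⧸ w.1.asIdeal)ˣ, z ∈ H ↔ z ^ (q + 1) = 1 := fun z => by
    rw [MonoidHom.mem_ker, powMonoidHom_apply]
  have hcardH : Nat.card H = q + 1 := by
    rw [← card_residue_pow_card_succ_eq_one E c v hc hv w hw]
    exact Nat.card_congr (Equiv.subtypeEquivRight hmem)
  have hcop : (Nat.card H).Coprime N := by rw [hcardH]; exact hN.symm
  obtain ⟨y, hy⟩ := (Nat.Coprime.pow_left_bijective hcop).2 ⟨x, (hmem x).2 hx⟩
  refine ⟨(y : (𝓞 E ⧸ w.1.asIdeal)ˣ), (hmem _).1 y.2, ?_⟩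
  have := congrArg Subtype.val hy
  simpa only [SubmonoidClass.coe_pow] using this

end ResidueNormOne

end Literature.NumberTheory.Automorphic.Liu2021.LemD1IndexedNonVacuityInertFrobenius

end
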